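import Literature.NumberTheory.Transcendental.QuadraticRelationsLogarithmsSec5Local
import Literature.NumberTheory.Transcendental.QuadraticRelationsLogarithmsSec5Endgame
import Literature.NumberTheory.Transcendental.QuadraticRelationsLogarithmsSec5Reductions
import HarnessLib

/-!
# Roy–Waldschmidt 1997, §5: Théorème 5.1 from Théorèmes 2.1, 3.1 and 4.1 (the global assembly)

D. Roy, M. Waldschmidt, *Approximation diophantienne et indépendance algébrique de logarithmes*,
Ann. Sci. ÉNS (4) 30 (1997) 753–796, proof of Théorème 5.1, pp. 780–784.

`h51sub_generic_of_thms`: in the generic case of Théorème 5.1 (`d > 2n > 0`, `n ≥ d₀`, `d₁ > 0`,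
`Y ⊄ ℂ^{d₀} × 0`, see `…Sec5Reductions.lean`), the subspace form (5.1) of the conclusion holds for
every object `X = (d₀, d₁, W, Y, Y_a)` over a finitely generated field `K ⊂ ℂ` of transcendence
degree `1`, GIVEN Théorème 2.1 (`h21`, = Waldschmidt 1997 [33] Thm. 2.1, the paper's only external
input), Théorème 3.1 (`h31`) and Théorème 4.1 (`h41`) as hypotheses.  The proof is the printed
one: choice of the bases (p. 780–781, `…Sec5Basis/Data`), of `κ` and `D` "assez grands"
(explicit thresholds, `…Sec5Params/Numerics`), the place of Théorème 3.1, the local step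
(`sec5_local`, `…Sec5Local.lean`), inequality (5.3) (`Sec5.ineq53_of_product`) and the endgame
p. 784 (`h51sub_clause_of_ineq53`), for the saturated object `X^{sat}` and then for `X`
(`RWObj.ellA_sub_le_sat`).

Also: `LinGroup.ConnAlgSubgroup.isKRational_rat_torusTangent` (the tangent space of a subtorus
is defined over `ℚ`), and the wrappers `h51sub_of_thms` (all objects, via `h51_of_generic`) and
**`royWaldschmidt_quadratic_thm_0_2_of_thms`**: Théorème 0.2 of the paper follows from
Théorèmes 2.1, 3.1, 4.1.  No definitions, no named facts.

## References

* [RoyWaldschmidt1997ENS] D. Roy, M. Waldschmidt, Ann. Sci. ÉNS (4) 30 (1997) 753–796, proof of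
  Théorème 5.1, pp. 780–784; Théorème 2.1 pp. 761–762; Théorème 3.1 p. 763; Théorème 4.1 p. 772.
* [Waldschmidt1997Crelle] M. Waldschmidt, J. reine angew. Math. 493 (1997) 61–113, Théorème 2.1.
-/

noncomputable section

open Complex IntermediateField Module Submodule

namespace Literature.NumberTheory.Transcendental

open LiePresentation

/-! ### The tangent space of a subtorus is defined over `ℚ` -/

/-- `T_{L₁} = {v ; ∑ⱼ χⱼ vⱼ = 0 ∀ χ ∈ M}` is defined over `ℚ` (it is cut out by finitely many
integral linear forms). [folklore] -/
theorem LinGroup.ConnAlgSubgroup.isKRational_rat_torusTangent {d₀ d₁ : ℕ} (L : LinGroup.ConnAlgSubgroup d₀ d₁) :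
    IsKRational ℚ L.torusTangent := by
  classical
  set N : Submodule ℤ (Fin d₁ → ℤ) := AddSubgroup.toIntSubmodule L.chars with hN
  obtain ⟨s, hs⟩ : N.FG := IsNoetherian.noetherian N
  set b := s.card
  set e : Fin b ≃ s := s.equivFin.symm with he
  set χ : Fin b → Fin d₁ → ℤ := fun l => ((e l : Fin d₁ → ℤ)) with hχ
  have hχmem : ∀ l, χ l ∈ L.chars := fun l => by
    have : (χ l) ∈ N := hs ▸ Submodule.subset_span (e l).2
    exact this
  -- the linear maps cutting out `T_{L₁}`
  set g₁ : (Fin d₁ → ℂ) →ₗ[ℂ] (Fin b → ℂ) :=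
    { toFun := fun v l => ∑ j, (χ l j : ℂ) * v j
      map_add' := fun v v' => by funext l; simp [mul_add, Finset.sum_add_distrib]
      map_smul' := fun c v => by funext l; simp [Finset.mul_sum, mul_left_comm] } with hg₁
  set g₁₀ : (Fin d₁ → ℚ) →ₗ[ℚ] (Fin b → ℚ) :=
    { toFun := fun v l => ∑ j, (χ l j : ℚ) * v j
      map_add' := fun v v' => by funext l; simp [mul_add, Finset.sum_add_distrib]
      map_smul' := fun c v => by funext l; simp [Finset.mul_sum, mul_left_comm] } with hg₁₀
  have hcompat : ∀ q : Fin d₁ → ℚ, g₁ (fun j => ((q j : ℚ) : ℂ)) = fun i => ((g₁₀ q i : ℚ) : ℂ) := by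
    intro q; funext l; simp [hg₁, hg₁₀]
  have hker : LinearMap.ker g₁ = L.torusTangent := by
    ext v
    rw [LinearMap.mem_ker, LinGroup.ConnAlgSubgroup.mem_torusTangent_iff]
    constructor
    · intro hv χ' hχ'
      have hχ'N : χ' ∈ N := hχ'
      rw [← hs] at hχ'N
      refine Submodule.span_induction (p := fun χ' _ => ∑ j, (χ' j : ℂ) * v j = 0) ?_ ?_ ?_ ?_ hχ'N
      · intro x hx
        have := congr_fun hv (e.symm ⟨x, hx⟩)
        simpa [hg₁, hχ] using this
      · simp
      · intro x y _ _ hx hy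
        simp only [Pi.add_apply, Int.cast_add, add_mul, Finset.sum_add_distrib, hx, hy, add_zero]
      · intro n x _ hx
        simp only [Pi.smul_apply, smul_eq_mul, Int.cast_mul, mul_assoc, ← Finset.mul_sum, hx, mul_zero]
    · intro hv
      funext l
      exact hv (χ l) (hχmem l)
  rw [← hker]
  exact RoyWaldschmidt1997.isKRational_ker_rat g₁ g₁₀ hcompat

namespace RoyWaldschmidt1997

open LinGroup
open Literature.NumberTheory.DiophantineGeometry
open Literature.NumberTheory.DiophantineGeometry.AlgFunctionField

variable {K : IntermediateField ℚ ℂ}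

set_option maxHeartbeats 2000000 in
/-- **Théorème 5.1, generic case, from Théorèmes 2.1, 3.1, 4.1** (subspace form (5.1)): for
`K ⊂ ℂ` finitely generated of transcendence degree `1` and an object `X` with `d > 2n > 0`,
`n ≥ d₀`, `d₁ > 0`, `Y ⊄ ℂ^{d₀} × 0`, there is an algebraic subgroup `L = T₀ × T₁ ≠ G`
(`T₀` over `K`, `T₁` a subtorus) satisfying (5.1) for all small `ε > 0`.
[cite: RoyWaldschmidt1997ENS, Théorème 5.1, p. 779 and its proof, pp. 780–784] -/
theorem h51sub_generic_of_thms
    (h21 : ∀ (d₀ d₁ ℓ₀ : ℕ) (N : Type) [Fintype N] (w : Fin ℓ₀ → (Fin d₀ → ℂ) × (Fin d₁ → ℂ))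
      (η : N → (Fin d₀ → ℂ) × (Fin d₁ → ℂ))
      (Kt : IntermediateField ℚ ℂ) [FiniteDimensional ℚ Kt]
      (wt : Fin ℓ₀ → (Fin d₀ → ℂ) × (Fin d₁ → ℂ)) (ηt : N → (Fin d₀ → ℂ) × (Fin d₁ → ℂ))
      (A : Fin d₁ → ℝ) (B₁ B₂ E U V : ℝ) (S₀ T₀ T₁ : ℕ),
      (∀ j, (∀ i, (wt j).1 i ∈ Kt) ∧ ∀ i, (wt j).2 i ∈ Kt) →
      (∀ j, (∀ i, (ηt j).1 i ∈ Kt) ∧ ∀ i, cexp ((ηt j).2 i) ∈ Kt) →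
      (∃ j, LinGroup.exp (ηt j) = 1) →
      (∃ j, (η j).2 ≠ 0) →
      (∀ i, Real.exp 1 ≤ A i) → Real.exp 1 ≤ B₁ → Real.exp 1 ≤ B₂ → Real.exp 1 ≤ E → 0 < U → 0 < V →
      0 < S₀ → 0 < T₀ → 0 < T₁ → 2 * ((d₀ : ℝ) + d₁) ≤ B₁ → ((d₀ : ℝ) + d₁) ≤ B₂ →
      (∀ i : Fin d₀, weilHeight₁ Kt (fun j : N => (ηt j).1 i) ≤ Real.log B₁) →
      (∀ j, weilHeight₁ Kt (Sum.elim (wt j).1 (wt j).2 : Fin d₀ ⊕ Fin d₁ → ℂ) ≤ Real.log B₂) →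
      (∀ (i : Fin d₁) (j : N), weilHeight₁ Kt (fun _ : Unit => cexp ((ηt j).2 i)) ≤ Real.log (A i) ∧
        2 / (Module.finrank ℚ Kt : ℝ) ≤ Real.log (A i) ∧
        E / (Module.finrank ℚ Kt : ℝ) * ‖(ηt j).2 i‖ ≤ Real.log (A i)) →
      (∀ j, ‖w j - wt j‖ ≤ Real.exp (-V)) → (∀ j, ‖η j - ηt j‖ ≤ Real.exp (-V)) →
      (Module.finrank ℚ Kt : ℝ) * (T₀ * Real.log B₁) ≤ U →
      (Module.finrank ℚ Kt : ℝ) * (S₀ * Real.log B₂) ≤ U →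
      (Module.finrank ℚ Kt : ℝ) * (T₁ * ∑ i, Real.log (A i)) ≤ U →
      (12 * ((d₀ : ℝ) + d₁) + 13) * U ≤ V →
      Real.log E ≤ (Module.finrank ℚ Kt : ℝ) * Real.log B₁ →
      Real.log E ≤ (Module.finrank ℚ Kt : ℝ) * Real.log B₂ →
      ((d₀ : ℝ) + d₁) * S₀ + T₀ + d₁ * T₁ ≤ B₂ →
      ((Nat.choose (T₀ + d₀) d₀ : ℝ) * ((T₁ : ℝ) + 1) ^ d₁ ≤ 1 / 8 * Real.exp (U / (2 * Module.finrank ℚ Kt))) →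
      (4 * (V / Real.log E) ^ (Module.finrank ℂ (Submodule.span ℂ (Set.range w ∪ Set.range η))) ≤
        (Nat.choose (T₀ + d₀) d₀ : ℝ) * ((T₁ : ℝ) + 1) ^ d₁) →
      ∃ H : LinGroup.ConnAlgSubgroup d₀ d₁,
        H.tangent ≠ ⊤ ∧ LiePresentation.IsKRational Kt H.addPart ∧
        (∃ F : Set (MvPolynomial (Fin d₀ ⊕ Fin d₁) ℂ),
          (∀ P ∈ F, (∀ m, P.coeff m ∈ Kt) ∧ ∀ i : Fin d₁, P.degreeOf (Sum.inr i) ≤ T₁) ∧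
          (∀ g ∈ H.toSubgroup, ∀ P ∈ F, LinGroup.evalAt P g = 0) ∧
          ∀ H' : LinGroup.ConnAlgSubgroup d₀ d₁, H.toSubgroup ≤ H'.toSubgroup →
            (∀ g ∈ H'.toSubgroup, ∀ P ∈ F, LinGroup.evalAt P g = 0) → H'.toSubgroup = H.toSubgroup) ∧
        S₀ ^ (Module.finrank Kt ↥(Submodule.span Kt (Set.range wt)) -
            Module.finrank Kt ↥(Submodule.span Kt (Set.range wt) ⊓ (H.tangent.restrictScalars Kt))) *
          Set.ncard ((QuotientGroup.mk : LinGroup d₀ d₁ → LinGroup d₀ d₁ ⧸ H.toSubgroup) ''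
            Set.range (fun j => LinGroup.exp (ηt j))) *
          T₀ ^ H.addDim * T₁ ^ H.torusDim ≤
        (d₀ + d₁).factorial / d₀.factorial * T₀ ^ d₀ * T₁ ^ d₁)
    (h31 : ∀ (ι : Type) [Fintype ι] (a : ι → K), ∃ c : ℝ, 0 < c ∧ ∀ κ : ℝ, c ≤ κ → ∀ D₀ : ℕ, ∃ D : ℕ, D₀ ≤ D ∧
      ∃ (p : Place K) (τ : p.ring →+* ℂ) (Kt : IntermediateField ℚ ℂ), p.IsReduction τ ∧ p.deg = D ∧
        (∀ x, τ x ∈ Kt) ∧ FiniteDimensional ℚ Kt ∧ Module.finrank ℚ Kt = D ∧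
        ∃ ha : ∀ i, a i ∈ p.ring,
          weilHeight₁ Kt (fun i => τ ⟨a i, ha i⟩) ≤ κ ∧
          (∀ i, ‖(a i : ℂ) - τ ⟨a i, ha i⟩‖ ≤ Real.exp (-(κ * (D : ℝ) ^ 2 / c))) ∧
          ∀ i, IsAlgebraic ℚ (a i : ℂ) → τ ⟨a i, ha i⟩ = a i)
    (h41 : ∀ (d₀ d₁ : ℕ) (p : Place K) (τ : p.ring →+* ℂ), p.IsReduction τ →
      ∀ (Kt : IntermediateField ℚ ℂ) [FiniteDimensional ℚ Kt], (∀ x, τ x ∈ Kt) → Module.finrank ℚ Kt = p.deg →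
      ∀ (ℓ₀ : ℕ) (N : Type) [Fintype N] (T₁ : ℕ) (w : Fin ℓ₀ → (Fin d₀ → ℂ) × (Fin d₁ → ℂ))
        (hw : ∀ j, (∀ i, (w j).1 i ∈ K) ∧ ∀ i, (w j).2 i ∈ K), LinearIndependent K w →
      ∀ (γ : N → LinGroup d₀ d₁)
        (hγ : ∀ j, (∀ i, Multiplicative.toAdd (γ j).1 i ∈ K) ∧ ∀ i, ((γ j).2 i : ℂ) ∈ K)
        (H : LinGroup.ConnAlgSubgroup d₀ d₁), LiePresentation.IsKRational Kt H.addPart →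
      (∃ F : Set (MvPolynomial (Fin d₀ ⊕ Fin d₁) ℂ),
          (∀ P ∈ F, (∀ m, P.coeff m ∈ Kt) ∧ ∀ i : Fin d₁, P.degreeOf (Sum.inr i) ≤ T₁) ∧
          (∀ g ∈ H.toSubgroup, ∀ P ∈ F, LinGroup.evalAt P g = 0) ∧
          ∀ H' : LinGroup.ConnAlgSubgroup d₀ d₁, H.toSubgroup ≤ H'.toSubgroup →
            (∀ g ∈ H'.toSubgroup, ∀ P ∈ F, LinGroup.evalAt P g = 0) → H'.toSubgroup = H.toSubgroup) →
      (∀ j, (∀ i, (⟨(w j).1 i, (hw j).1 i⟩ : K) ∈ p.ring) ∧ ∀ i, (⟨(w j).2 i, (hw j).2 i⟩ : K) ∈ p.ring) →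
      (∀ j, (∀ i, (⟨Multiplicative.toAdd (γ j).1 i, (hγ j).1 i⟩ : K) ∈ p.ring) ∧
        ∀ i, (⟨((γ j).2 i : ℂ), (hγ j).2 i⟩ : K) ∈ p.ring ∧ (⟨((γ j).2 i : ℂ)⁻¹, inv_mem ((hγ j).2 i)⟩ : K) ∈ p.ring) →
      ∀ (wt : Fin ℓ₀ → (Fin d₀ → ℂ) × (Fin d₁ → ℂ)) (γt : N → LinGroup d₀ d₁),
      (∀ j, (∀ i (h : (⟨(w j).1 i, (hw j).1 i⟩ : K) ∈ p.ring), (wt j).1 i = τ ⟨_, h⟩) ∧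
        ∀ i (h : (⟨(w j).2 i, (hw j).2 i⟩ : K) ∈ p.ring), (wt j).2 i = τ ⟨_, h⟩) →
      (∀ j, (∀ i (h : (⟨Multiplicative.toAdd (γ j).1 i, (hγ j).1 i⟩ : K) ∈ p.ring),
          Multiplicative.toAdd (γt j).1 i = τ ⟨_, h⟩) ∧
        ∀ i (h : (⟨((γ j).2 i : ℂ), (hγ j).2 i⟩ : K) ∈ p.ring), ((γt j).2 i : ℂ) = τ ⟨_, h⟩) →
      ∀ (A' : Fin d₁ → ℝ) (B₁ B₂ : ℝ), (∀ i, Real.exp 1 ≤ A' i) → Real.exp 1 ≤ B₁ → Real.exp 1 ≤ B₂ →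
      (∀ i : Fin d₀, (ffHeight₁ (fun j : N => (⟨Multiplicative.toAdd (γ j).1 i, (hγ j).1 i⟩ : K)) : ℝ) ≤ Real.log B₁) →
      (∀ j, (ffHeight₁ (Sum.elim (fun i => (⟨(w j).1 i, (hw j).1 i⟩ : K)) (fun i => (⟨(w j).2 i, (hw j).2 i⟩ : K))) : ℝ)
        ≤ Real.log B₂) →
      (∀ (i : Fin d₁) (j : N), (ffHeight₁ (fun _ : Unit => (⟨((γ j).2 i : ℂ), (hγ j).2 i⟩ : K)) : ℝ) ≤ Real.log (A' i)) →
      max (2 * (d₁ : ℝ) * ((T₁ : ℝ) * ∑ i, Real.log (A' i))) (2 * (d₀ : ℝ) * Real.log B₁ + ℓ₀ * Real.log B₂) < p.deg →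
      ∃ L : LinGroup.ConnAlgSubgroup d₀ d₁,
        LiePresentation.IsKRational K L.addPart ∧ L.addDim = H.addDim ∧ L.torusDim = H.torusDim ∧
        Set.ncard ((QuotientGroup.mk : LinGroup d₀ d₁ → LinGroup d₀ d₁ ⧸ L.toSubgroup) '' Set.range γ) ≤
          Set.ncard ((QuotientGroup.mk : LinGroup d₀ d₁ → LinGroup d₀ d₁ ⧸ H.toSubgroup) '' Set.range γt) ∧
        Module.finrank K ↥(Submodule.span K (Set.range w)) -
            Module.finrank K ↥(Submodule.span K (Set.range w) ⊓ (L.tangent.restrictScalars K)) ≤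
          Module.finrank Kt ↥(Submodule.span Kt (Set.range wt)) -
            Module.finrank Kt ↥(Submodule.span Kt (Set.range wt) ⊓ (H.tangent.restrictScalars Kt)))
    (hfg : K.FG) (htr : Algebra.trdeg ℚ K = 1) (X : RWObj K)
    (h2n : 2 * X.nn < X.d₀ + X.d₁) (hn : 0 < X.nn) (hd₀n : X.d₀ ≤ X.nn) (hd₁ : 0 < X.d₁)
    (hY : ∃ y ∈ X.Y, y.2 ≠ 0) :
    ∃ (T₀ : Submodule ℂ (Fin X.d₀ → ℂ)) (T₁ : Submodule ℂ (Fin X.d₁ → ℂ)),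
      IsKRational K T₀ ∧ IsKRational ℚ T₁ ∧ (T₀ ≠ ⊤ ∨ T₁ ≠ ⊤) ∧
      ∀ ε : ℝ, 0 < ε → ε ≤ 1 / (2 * ((X.d₀ : ℝ) + X.d₁) * (((X.d₀ : ℝ) + X.d₁) + ((X.ell₁ : ℝ) - X.kap)) + 1) →
        ((((X.d₀ : ℝ) + X.d₁) - 2 * X.nn) + ε * ((X.nn : ℝ) - X.d₀)) *
            (((X.d₁ : ℝ) - Module.finrank ℂ T₁) + ((X.ell₁ : ℝ) -
              Module.finrank ℤ ↥(X.Y ⊓ ((T₀.prod T₁).restrictScalars ℤ ⊔ omegaLattice X.d₀ X.d₁)))) ≤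
          (X.d₁ : ℝ) * (((((X.d₀ : ℝ) - Module.finrank ℂ T₀) + ((X.d₁ : ℝ) - Module.finrank ℂ T₁)) -
              ((X.ell₀ : ℝ) - Module.finrank K ↥(X.W ⊓ (T₀.prod T₁).restrictScalars K))) +
            ε * (((X.ell₀ : ℝ) - Module.finrank K ↥(X.W ⊓ (T₀.prod T₁).restrictScalars K)) -
              ((X.d₀ : ℝ) - Module.finrank ℂ T₀)) -
            ε ^ 2 * ((X.ellA : ℝ) -
              Module.finrank ℤ ↥(X.Ya ⊓ ((T₀.prod T₁).restrictScalars ℤ ⊔ omegaLattice X.d₀ X.d₁)))) := by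
  classical
  haveI : IsAlgFunctionField ℚ K := isAlgFunctionField_of_fg hfg htr
  /- ## the data (p. 780–781) -/
  obtain ⟨a, c, η, hηli, hηY, hηA, ha, hac⟩ := X.exists_adapted_basis
  obtain ⟨w, hw, hwli, hwW, hwC⟩ := X.exists_K_basis_W
  have hηmem : ∀ m, η m ∈ X.Y := fun m => hηY ▸ Submodule.subset_span ⟨m, rfl⟩
  have hη1K : ∀ m i, (η m).1 i ∈ K := fun m i => (X.hY _ (hηmem m)).1 i
  have hγKm : ∀ m i, cexp ((η m).2 i) ∈ K := fun m i => (X.hY _ (hηmem m)).2 i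
  set η1 : Fin a ⊕ Fin c → Fin X.d₀ → K := fun m i => ⟨(η m).1 i, hη1K m i⟩ with hη1def
  set γK : Fin a ⊕ Fin c → Fin X.d₁ → K := fun m i => ⟨cexp ((η m).2 i), hγKm m i⟩ with hγKdef
  have hγalgC : ∀ (m : Fin a) (i : Fin X.d₁), IsAlgebraic ℚ (cexp ((η (Sum.inl m)).2 i)) := by
    intro m i
    have hmem : η (Sum.inl m) ∈ X.YaSat := hηA ▸ Submodule.subset_span ⟨m, rfl⟩
    exact (RWObj.mem_algExpSub.mp hmem.2) i
  have hγalg : ∀ (m : Fin a) (i : Fin X.d₁), IsAlgebraic ℚ (γK (Sum.inl m) i) := fun m i =>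
    IntermediateField.isAlgebraic_iff.mpr (hγalgC m i)
  have hY2 : ∃ m, (η m).2 ≠ 0 := exists_snd_ne_zero η X.Y hηY hY
  /- ## constants -/
  have hCγex : ∀ mi : Fin a × Fin X.d₁, ∃ C : ℝ, 0 ≤ C ∧ ∀ (F : IntermediateField ℚ ℂ) [FiniteDimensional ℚ F],
      (γK (Sum.inl mi.1) mi.2 : ℂ) ∈ F → weilHeight₁ F (fun _ : Unit => (γK (Sum.inl mi.1) mi.2 : ℂ)) ≤ C :=
    fun mi => exists_weilHeight₁_le_of_isAlgebraic (hγalgC mi.1 mi.2)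
  choose Cγf hCγf0 hCγf using hCγex
  set Cγ : ℝ := ∑ mi, Cγf mi with hCγdef
  have hCγ0 : 0 ≤ Cγ := Finset.sum_nonneg fun mi _ => hCγf0 mi
  have hCγ : ∀ (m : Fin a) (i : Fin X.d₁) (F : IntermediateField ℚ ℂ) [FiniteDimensional ℚ F],
      (γK (Sum.inl m) i : ℂ) ∈ F → weilHeight₁ F (fun _ : Unit => (γK (Sum.inl m) i : ℂ)) ≤ Cγ := by
    intro m i F _ hF
    exact (hCγf (m, i) F hF).trans (Finset.single_le_sum (fun mi _ => hCγf0 mi) (Finset.mem_univ (m, i)))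
  set Cη : ℝ := ∑ m, ‖η m‖ with hCηdef
  have hCη0 : 0 ≤ Cη := Finset.sum_nonneg fun m _ => norm_nonneg _
  have hCη : ∀ m, ‖η m‖ ≤ Cη := fun m => Finset.single_le_sum (fun m _ => norm_nonneg (η m)) (Finset.mem_univ m)
  -- the tuple of all the elements of `K` to be approximated (Théorème 3.1)
  set wK : Fin X.ell₀ → Fin X.d₀ ⊕ Fin X.d₁ → K :=
    fun j => Sum.elim (fun i => (⟨(w j).1 i, (hw j).1 i⟩ : K)) (fun i => (⟨(w j).2 i, (hw j).2 i⟩ : K)) with hwKdef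
  set tup : (Fin X.ell₀ × (Fin X.d₀ ⊕ Fin X.d₁)) ⊕ ((Fin a ⊕ Fin c) × Fin X.d₀) ⊕ ((Fin a ⊕ Fin c) × Fin X.d₁) → K :=
    Sum.elim (fun ji => wK ji.1 ji.2) (Sum.elim (fun mi => η1 mi.1 mi.2) (fun mi => γK mi.1 mi.2)) with htupdef
  set Hff : ℕ := ffHeight₁ tup with hHffdef
  have hHff1 : ffHeight₁ (fun mi : (Fin a ⊕ Fin c) × Fin X.d₀ => η1 mi.1 mi.2) ≤ Hff :=
    ffHeight₁_comp_le' tup (fun mi : (Fin a ⊕ Fin c) × Fin X.d₀ => Sum.inr (Sum.inl mi))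
  have hHff2 : ∀ m i, ffHeight₁ (fun _ : Unit => γK m i) ≤ Hff := fun m i =>
    ffHeight₁_comp_le' tup (fun _ : Unit => Sum.inr (Sum.inr (m, i)))
  have hHff3 : ∀ j, ffHeight₁ (Sum.elim (fun i => (⟨(w j).1 i, (hw j).1 i⟩ : K))
      (fun i => (⟨(w j).2 i, (hw j).2 i⟩ : K))) ≤ Hff := by
    intro j
    have h := ffHeight₁_comp_le' tup (fun x : Fin X.d₀ ⊕ Fin X.d₁ => Sum.inl (j, x))
    have e : tup ∘ (fun x : Fin X.d₀ ⊕ Fin X.d₁ => Sum.inl (j, x)) =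
        Sum.elim (fun i => (⟨(w j).1 i, (hw j).1 i⟩ : K)) (fun i => (⟨(w j).2 i, (hw j).2 i⟩ : K)) := by
      funext x; rcases x with i | i <;> rfl
    rwa [e] at h
  /- ## thresholds: Théorème 3.1, (5.3), the parameter bounds -/
  obtain ⟨c₃₁, hc₃₁, h31'⟩ := h31 _ tup
  have hCn : 1 ≤ (X.d₀ + X.d₁).factorial / X.d₀.factorial :=
    Nat.div_pos (Nat.factorial_le (Nat.le_add_right _ _)) (Nat.factorial_pos _)
  obtain ⟨κ₀, -, h53⟩ := Sec5.ineq53_of_product X.d₀ X.d₁ X.nn (X.ell₁ - X.kap)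
    ((X.d₀ + X.d₁).factorial / X.d₀.factorial)
    ((X.d₀ + X.d₁) * (X.nn + 3 * (X.ell₁ - X.kap) + (X.d₀ + X.d₁) + 1) + 1 +
      2 * (X.d₀ + X.d₁) * ((X.d₀ + X.d₁) + (X.ell₁ - X.kap))) hn hd₀n h2n hd₁ hCn (Nat.le_add_right _ _)
  set KV : ℝ := 4 * 2 ^ X.d₀ * (X.d₀.factorial : ℝ) / (4 * c₃₁) ^ X.nn with hKVdef
  have hKV0 : 0 ≤ KV := by positivity
  set k₁ : ℝ := 4 * c₃₁ * (12 * ((X.d₀ : ℝ) + X.d₁) + 13) * X.d₁ + X.d₁ + ((a : ℝ) * Cγ + c) +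
    ((a : ℝ) + c) * (Cη + 1) + (c : ℝ) * Hff + (2 * (X.d₁ : ℝ) ^ 2 + 1) + KV with hk₁def
  set L₁ : ℝ → ℝ := fun κ => 2 * (((X.d₀ : ℝ) + X.d₁) + 1) * |κ| +
    2 * (8 * c₃₁ * (12 * ((X.d₀ : ℝ) + X.d₁) + 13) * (((X.d₀ : ℝ) + X.d₁) + 1)) +
    2 * (2 * (X.d₀ : ℝ) + X.ell₀ + 1) + (X.d₁ : ℝ) * |Real.log (2 * ((a : ℝ) + c) * κ) + κ| +
    ((Hff : ℝ) + 1) + 2 * ((a : ℝ) + c) * Real.exp Cη * c₃₁ + c₃₁ * (Real.log 2 + Cη) with hL₁def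
  obtain ⟨κ₁, -, hpb⟩ := Sec5.param_bounds X.d₀ X.d₁ X.nn hn hd₀n h2n hd₁ k₁ L₁
  -- `κ`
  set κ : ℝ := max (max c₃₁ κ₀) (max κ₁ 1) with hκdef
  have hκc : c₃₁ ≤ κ := (le_max_left _ _).trans (le_max_left _ _)
  have hκ₀ : κ₀ ≤ κ := (le_max_right _ _).trans (le_max_left _ _)
  have hκ₁ : κ₁ ≤ κ := (le_max_left _ _).trans (le_max_right _ _)
  have hκ1 : 1 ≤ κ := (le_max_right _ _).trans (le_max_right _ _)
  obtain ⟨hk₁k, D₁, -, hpbD⟩ := hpb κ hκ₁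
  obtain ⟨D₀, hD₀3, h53D⟩ := h53 κ hκ₀
  -- `D` and the place (Théorème 3.1)
  obtain ⟨D, hDge, p, τ, Kt, hτ, hpD, hτKt, hfd, hKtD, htup, hhtup, hatup, hfixtup⟩ := h31' κ hκc (max D₀ D₁)
  haveI : FiniteDimensional ℚ Kt := hfd
  obtain ⟨hL₁D, hκL, hk3, hkκ, hLg3, hT0c, hT1c, hSc⟩ := hpbD D (le_of_max_le_right hDge)
  obtain ⟨-, ε₁, ε₂, ε₃, hε₃, hε32, hε21, hε1, h53'⟩ := h53D D (le_of_max_le_left hDge)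
  /- ## the hypotheses of the local step -/
  have hη1r : ∀ m i, η1 m i ∈ p.ring := fun m i => htup (Sum.inr (Sum.inl (m, i)))
  have hγr : ∀ m i, γK m i ∈ p.ring := fun m i => htup (Sum.inr (Sum.inr (m, i)))
  have hwr : ∀ j, (∀ i, (⟨(w j).1 i, (hw j).1 i⟩ : K) ∈ p.ring) ∧ ∀ i, (⟨(w j).2 i, (hw j).2 i⟩ : K) ∈ p.ring :=
    fun j => ⟨fun i => htup (Sum.inl (j, Sum.inl i)), fun i => htup (Sum.inl (j, Sum.inr i))⟩
  have hhη1 : ∀ i, weilHeight₁ Kt (fun m => τ ⟨η1 m i, hη1r m i⟩) ≤ κ := fun i =>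
    (weilHeight₁_comp_le Kt (fun m : Fin a ⊕ Fin c => (Sum.inr (Sum.inl (m, i)) : (Fin X.ell₀ × (Fin X.d₀ ⊕ Fin X.d₁)) ⊕
      ((Fin a ⊕ Fin c) × Fin X.d₀) ⊕ ((Fin a ⊕ Fin c) × Fin X.d₁)))
      (fun l => τ ⟨tup l, htup l⟩) (fun l => hτKt _)).trans hhtup
  have hhγ : ∀ m i, weilHeight₁ Kt (fun _ : Unit => τ ⟨γK m i, hγr m i⟩) ≤ κ := fun m i =>
    (weilHeight₁_comp_le Kt (fun _ : Unit => (Sum.inr (Sum.inr (m, i)) : (Fin X.ell₀ × (Fin X.d₀ ⊕ Fin X.d₁)) ⊕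
      ((Fin a ⊕ Fin c) × Fin X.d₀) ⊕ ((Fin a ⊕ Fin c) × Fin X.d₁)))
      (fun l => τ ⟨tup l, htup l⟩) (fun l => hτKt _)).trans hhtup
  have hhw : ∀ j, weilHeight₁ Kt (Sum.elim (fun i => τ ⟨_, (hwr j).1 i⟩) (fun i => τ ⟨_, (hwr j).2 i⟩) :
      Fin X.d₀ ⊕ Fin X.d₁ → ℂ) ≤ κ := by
    intro j
    have h := weilHeight₁_comp_le Kt (fun x : Fin X.d₀ ⊕ Fin X.d₁ => (Sum.inl (j, x) :
      (Fin X.ell₀ × (Fin X.d₀ ⊕ Fin X.d₁)) ⊕ ((Fin a ⊕ Fin c) × Fin X.d₀) ⊕ ((Fin a ⊕ Fin c) × Fin X.d₁)))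
      (fun l => τ ⟨tup l, htup l⟩) (fun l => hτKt _)
    have e : (fun l => τ ⟨tup l, htup l⟩) ∘ (fun x : Fin X.d₀ ⊕ Fin X.d₁ => (Sum.inl (j, x) :
        (Fin X.ell₀ × (Fin X.d₀ ⊕ Fin X.d₁)) ⊕ ((Fin a ⊕ Fin c) × Fin X.d₀) ⊕ ((Fin a ⊕ Fin c) × Fin X.d₁))) =
        (Sum.elim (fun i => τ ⟨_, (hwr j).1 i⟩) (fun i => τ ⟨_, (hwr j).2 i⟩) : Fin X.d₀ ⊕ Fin X.d₁ → ℂ) := by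
      funext x; rcases x with i | i <;> rfl
    rw [e] at h
    exact h.trans hhtup
  have haη1 : ∀ m i, ‖(η1 m i : ℂ) - τ ⟨η1 m i, hη1r m i⟩‖ ≤ Real.exp (-(κ * (D : ℝ) ^ 2 / c₃₁)) :=
    fun m i => hatup (Sum.inr (Sum.inl (m, i)))
  have haγ : ∀ m i, ‖(γK m i : ℂ) - τ ⟨γK m i, hγr m i⟩‖ ≤ Real.exp (-(κ * (D : ℝ) ^ 2 / c₃₁)) :=
    fun m i => hatup (Sum.inr (Sum.inr (m, i)))
  have haw : ∀ j, (∀ i, ‖(w j).1 i - τ ⟨_, (hwr j).1 i⟩‖ ≤ Real.exp (-(κ * (D : ℝ) ^ 2 / c₃₁))) ∧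
      ∀ i, ‖(w j).2 i - τ ⟨_, (hwr j).2 i⟩‖ ≤ Real.exp (-(κ * (D : ℝ) ^ 2 / c₃₁)) :=
    fun j => ⟨fun i => hatup (Sum.inl (j, Sum.inl i)), fun i => hatup (Sum.inl (j, Sum.inr i))⟩
  have hfix : ∀ (m : Fin a) (i : Fin X.d₁), τ ⟨γK (Sum.inl m) i, hγr _ i⟩ = γK (Sum.inl m) i :=
    fun m i => hfixtup (Sum.inr (Sum.inr (Sum.inl m, i))) (hγalgC m i)
  -- largeness of `k = log κ` and of `D`
  have hterms : 0 ≤ 4 * c₃₁ * (12 * ((X.d₀ : ℝ) + X.d₁) + 13) * X.d₁ ∧ (0 : ℝ) ≤ X.d₁ ∧ 0 ≤ (a : ℝ) * Cγ + c ∧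
      0 ≤ ((a : ℝ) + c) * (Cη + 1) ∧ 0 ≤ (c : ℝ) * Hff ∧ 0 ≤ 2 * (X.d₁ : ℝ) ^ 2 + 1 ∧ 0 ≤ KV := by
    refine ⟨by positivity, by positivity, by positivity, ?_, by positivity, by positivity, hKV0⟩
    exact mul_nonneg (by positivity) (by linarith only [hCη0])
  obtain ⟨t1, t2, t3, t4, t5, t6, t7⟩ := hterms
  have hkU : 4 * c₃₁ * (12 * ((X.d₀ : ℝ) + X.d₁) + 13) * X.d₁ ≤ Real.log κ := by
    refine le_trans ?_ hk₁k; rw [hk₁def]; linarith only [t2, t3, t4, t5, t6, t7]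
  have hkd₁ : (X.d₁ : ℝ) ≤ Real.log κ := by
    refine le_trans ?_ hk₁k; rw [hk₁def]; linarith only [t1, t3, t4, t5, t6, t7]
  have hkA : (a : ℝ) * Cγ + c ≤ Real.log κ := by
    refine le_trans ?_ hk₁k; rw [hk₁def]; linarith only [t1, t2, t4, t5, t6, t7]
  have hkη : ((a : ℝ) + c) * (Cη + 1) ≤ Real.log κ := by
    refine le_trans ?_ hk₁k; rw [hk₁def]; linarith only [t1, t2, t3, t5, t6, t7]
  have hkH : (c : ℝ) * Hff ≤ Real.log κ := by
    refine le_trans ?_ hk₁k; rw [hk₁def]; linarith only [t1, t2, t3, t4, t6, t7]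
  have hk41 : 2 * (X.d₁ : ℝ) ^ 2 < Real.log κ := by
    refine lt_of_lt_of_le ?_ hk₁k; rw [hk₁def]; linarith only [t1, t2, t3, t4, t5, t7]
  have hkKV : KV ≤ Real.log κ := by
    refine le_trans ?_ hk₁k; rw [hk₁def]; linarith only [t1, t2, t3, t4, t5, t6]
  have hkV : 4 * 2 ^ X.d₀ * (X.d₀.factorial : ℝ) ≤ Real.log κ ^ X.d₁ * (4 * c₃₁) ^ X.nn := by
    have h1 : (1 : ℝ) ≤ Real.log κ := by linarith only [hk3]
    have h2 : Real.log κ ≤ Real.log κ ^ X.d₁ := by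
      calc Real.log κ = Real.log κ ^ 1 := (pow_one _).symm
        _ ≤ Real.log κ ^ X.d₁ := pow_le_pow_right₀ h1 hd₁
    have h3 : KV * (4 * c₃₁) ^ X.nn = 4 * 2 ^ X.d₀ * (X.d₀.factorial : ℝ) := by
      rw [hKVdef, div_mul_cancel₀ _ (by positivity)]
    rw [← h3]
    exact mul_le_mul (hkKV.trans h2) le_rfl (by positivity) (by positivity)
  have hL₁' : L₁ κ ≤ Real.log D := hL₁D
  have hLterms : 0 ≤ 2 * (((X.d₀ : ℝ) + X.d₁) + 1) * |κ| ∧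
      0 ≤ 2 * (8 * c₃₁ * (12 * ((X.d₀ : ℝ) + X.d₁) + 13) * (((X.d₀ : ℝ) + X.d₁) + 1)) ∧
      0 ≤ 2 * (2 * (X.d₀ : ℝ) + X.ell₀ + 1) ∧ 0 ≤ (X.d₁ : ℝ) * |Real.log (2 * ((a : ℝ) + c) * κ) + κ| ∧
      0 ≤ (Hff : ℝ) + 1 ∧ 0 ≤ 2 * ((a : ℝ) + c) * Real.exp Cη * c₃₁ ∧ 0 ≤ c₃₁ * (Real.log 2 + Cη) := by
    refine ⟨by positivity, by positivity, by positivity, by positivity, by positivity, by positivity, ?_⟩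
    exact mul_nonneg hc₃₁.le (add_nonneg (Real.log_nonneg (by norm_num)) hCη0)
  obtain ⟨u1, u2, u3, u4, u5, u6, u7⟩ := hLterms
  have hL₁κ : L₁ κ = 2 * (((X.d₀ : ℝ) + X.d₁) + 1) * |κ| +
    2 * (8 * c₃₁ * (12 * ((X.d₀ : ℝ) + X.d₁) + 13) * (((X.d₀ : ℝ) + X.d₁) + 1)) +
    2 * (2 * (X.d₀ : ℝ) + X.ell₀ + 1) + (X.d₁ : ℝ) * |Real.log (2 * ((a : ℝ) + c) * κ) + κ| +
    ((Hff : ℝ) + 1) + 2 * ((a : ℝ) + c) * Real.exp Cη * c₃₁ + c₃₁ * (Real.log 2 + Cη) := rfl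
  have hκabs : κ ≤ |κ| := le_abs_self κ
  have hDnat : 3 ≤ D := hD₀3.trans (le_of_max_le_left hDge)
  have hD0 : (0 : ℝ) < D := by exact_mod_cast (show 0 < D by omega)
  have hLgD : Real.log D ≤ (D : ℝ) := (Real.log_le_sub_one_of_pos hD0).trans (sub_le_self _ zero_le_one)
  have hLB : 2 * (((X.d₀ : ℝ) + X.d₁) + 1) * κ ≤ Real.log D := by
    have h1 : 2 * (((X.d₀ : ℝ) + X.d₁) + 1) * κ ≤ 2 * (((X.d₀ : ℝ) + X.d₁) + 1) * |κ| :=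
      mul_le_mul_of_nonneg_left hκabs (by positivity)
    linarith only [h1, hL₁', hL₁κ, u2, u3, u4, u5, u6, u7]
  have hLe : 2 * (8 * c₃₁ * (12 * ((X.d₀ : ℝ) + X.d₁) + 13) * (((X.d₀ : ℝ) + X.d₁) + 1)) ≤ Real.log D := by
    linarith only [hL₁', hL₁κ, u1, u3, u4, u5, u6, u7]
  have hL41 : 2 * (2 * (X.d₀ : ℝ) + X.ell₀ + 1) ≤ Real.log D := by
    linarith only [hL₁', hL₁κ, u1, u2, u4, u5, u6, u7]
  have hLadd : (X.d₁ : ℝ) * (Real.log (2 * ((a : ℝ) + c) * κ) + κ) ≤ Real.log D := by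
    have h1 : (X.d₁ : ℝ) * (Real.log (2 * ((a : ℝ) + c) * κ) + κ) ≤
        (X.d₁ : ℝ) * |Real.log (2 * ((a : ℝ) + c) * κ) + κ| :=
      mul_le_mul_of_nonneg_left (le_abs_self _) (by positivity)
    linarith only [h1, hL₁', hL₁κ, u1, u2, u3, u5, u6, u7]
  have hLH : (Hff : ℝ) + 1 ≤ Real.log D := by
    linarith only [hL₁', hL₁κ, u1, u2, u3, u4, u6, u7]
  have hDt : 2 * ((a : ℝ) + c) * Real.exp Cη * c₃₁ ≤ D := by
    linarith only [hL₁', hL₁κ, hLgD, u1, u2, u3, u4, u5, u7]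
  have hDt' : c₃₁ * (Real.log 2 + Cη) ≤ D := by
    linarith only [hL₁', hL₁κ, hLgD, u1, u2, u3, u4, u5, u6]
  /- ## the local step -/
  obtain ⟨L, hLK, hLtop, hprod⟩ := sec5_local h21 h41 X hd₀n hd₁ η hηli hηY hηA ha hac hY2 w hw hwli hwW hwC
    η1 (fun _ _ => rfl) γK (fun _ _ => rfl) hγalg hc₃₁ hκ1 hCγ0 hCγ hHff1 hHff2 hHff3 hCη0 hCη
    p τ hτ Kt hτKt hKtD hpD hη1r hγr hwr hhη1 hhγ hhw haη1 haγ haw hfix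
    ⟨hκL, hk3, hkκ, hLg3, hT0c, hT1c, hSc⟩ hkU hkd₁ hkA hkη hkH hk41 hkV hLB hLe hL41 hLadd hLH hDt hDt'
  /- ## (5.3) and the endgame (p. 784), for `X^{sat}` and then for `X` -/
  unfold LinGroup.ConnAlgSubgroup.tangent at hprod hLtop
  set T₀ : Submodule ℂ (Fin X.d₀ → ℂ) := L.addPart with hT₀def
  set T₁ : Submodule ℂ (Fin X.d₁ → ℂ) := L.torusTangent with hT₁def
  set SL : Submodule ℤ ((Fin X.d₀ → ℂ) × (Fin X.d₁ → ℂ)) :=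
    (T₀.prod T₁).restrictScalars ℤ ⊔ omegaLattice X.d₀ X.d₁ with hSLdef
  set wL : ℕ := Module.finrank K ↥(X.W ⊓ (T₀.prod T₁).restrictScalars K) with hwLdef
  set rY : ℕ := Module.finrank ℤ ↥(X.Y ⊓ SL) with hrYdef
  set rA : ℕ := Module.finrank ℤ ↥(X.YaSat ⊓ SL) with hrAdef
  set rkA : ℕ := Module.finrank ℤ ↥X.YaSat with hrkAdef
  have hwL : wL ≤ X.ell₀ := X.finrank_inf_le_ell₀ _
  have hrY : rY ≤ X.ell₁ := X.finrank_inf_le_ell₁ _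
  have hrA : rA ≤ rkA := X.sat.finrank_inf_le_ellA SL
  have hkap : X.kap ≤ rY := X.kap_le_finrank_inf SL le_sup_right
  have hlamA : rkA - rA ≤ X.ell₁ - rY := X.sat.ellA_sub_le_ell₁_sub SL
  have haL : L.addDim ≤ X.d₀ := by
    have := Submodule.finrank_le (R := ℂ) L.addPart
    rwa [Module.finrank_fin_fun] at this
  have htL : L.torusDim ≤ X.d₁ := by
    have := Submodule.finrank_le (R := ℂ) L.torusTangent
    rwa [Module.finrank_fin_fun] at this
  obtain ⟨δ, hδB, h0⟩ := h53' (X.d₀ - L.addDim) (X.d₁ - L.torusDim) (X.ell₀ - wL) (X.ell₁ - rY) (rkA - rA)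
    (Nat.sub_le _ _) (Nat.sub_le _ _) ((Nat.sub_le _ _).trans X.ell₀_le_nn) hlamA (by omega) hprod
  -- the real form of (5.3) for `X^{sat}`
  have e1 : ((X.d₀ - L.addDim : ℕ) : ℝ) = (X.d₀ : ℝ) - Module.finrank ℂ T₀ := by rw [Nat.cast_sub haL]; rfl
  have e2 : ((X.d₁ - L.torusDim : ℕ) : ℝ) = (X.d₁ : ℝ) - Module.finrank ℂ T₁ := by rw [Nat.cast_sub htL]; rfl
  have e3 : ((X.ell₀ - wL : ℕ) : ℝ) = (X.ell₀ : ℝ) - wL := by rw [Nat.cast_sub hwL]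
  have e4 : ((X.ell₁ - rY : ℕ) : ℝ) = (X.ell₁ : ℝ) - rY := by rw [Nat.cast_sub hrY]
  have e5 : ((rkA - rA : ℕ) : ℝ) = (rkA : ℝ) - rA := by rw [Nat.cast_sub hrA]
  rw [e1, e2, e3, e4, e5] at h0
  have h53X : 0 ≤
      ((X.d₁ : ℝ) * ((((X.d₀ : ℝ) - Module.finrank ℂ T₀) + ((X.d₁ : ℝ) - Module.finrank ℂ T₁)) -
            ((X.ell₀ : ℝ) - wL)) -
        (((X.d₀ : ℝ) + X.d₁) - 2 * X.nn) * (((X.d₁ : ℝ) - Module.finrank ℂ T₁) + ((X.ell₁ : ℝ) - rY)))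
      + ε₁ * ((X.d₁ : ℝ) * (((X.ell₀ : ℝ) - wL) - ((X.d₀ : ℝ) - Module.finrank ℂ T₀)) -
        ((X.nn : ℝ) - X.d₀) * (((X.d₁ : ℝ) - Module.finrank ℂ T₁) + ((X.ell₁ : ℝ) - rY)))
      - ε₂ * (((X.d₁ : ℝ) * (((X.ell₀ : ℝ) - wL) - ((X.d₀ : ℝ) - Module.finrank ℂ T₀)) -
        ((X.nn : ℝ) - X.d₀) * (((X.d₁ : ℝ) - Module.finrank ℂ T₁) + ((X.ell₁ : ℝ) - rY))) +
        (X.d₁ : ℝ) * ((rkA : ℝ) - rA))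
      + ε₃ * δ := by
    linarith only [h0]
  have hBn : 2 * (X.sat.d₀ + X.sat.d₁) * ((X.sat.d₀ + X.sat.d₁) + (X.sat.ell₁ - X.sat.kap)) ≤
      (X.d₀ + X.d₁) * (X.nn + 3 * (X.ell₁ - X.kap) + (X.d₀ + X.d₁) + 1) + 1 +
        2 * (X.d₀ + X.d₁) * ((X.d₀ + X.d₁) + (X.ell₁ - X.kap)) := Nat.le_add_left _ _
  have hclause := h51sub_clause_of_ineq53 X.sat h2n hd₀n T₀ T₁ hBn hδB hε₃ hε32 hε21 hε1 h53X
  have hclause' : ∀ ε : ℝ, 0 < ε →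
      ε ≤ 1 / (2 * ((X.d₀ : ℝ) + X.d₁) * (((X.d₀ : ℝ) + X.d₁) + ((X.ell₁ : ℝ) - X.kap)) + 1) →
        ((((X.d₀ : ℝ) + X.d₁) - 2 * X.nn) + ε * ((X.nn : ℝ) - X.d₀)) *
            (((X.d₁ : ℝ) - Module.finrank ℂ T₁) + ((X.ell₁ : ℝ) - rY)) ≤
          (X.d₁ : ℝ) * (((((X.d₀ : ℝ) - Module.finrank ℂ T₀) + ((X.d₁ : ℝ) - Module.finrank ℂ T₁)) -
              ((X.ell₀ : ℝ) - wL)) +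
            ε * (((X.ell₀ : ℝ) - wL) - ((X.d₀ : ℝ) - Module.finrank ℂ T₀)) -
            ε ^ 2 * ((rkA : ℝ) - rA)) := hclause
  have hLQ : IsKRational ℚ T₁ := L.isKRational_rat_torusTangent
  have hne : T₀ ≠ ⊤ ∨ T₁ ≠ ⊤ := by
    by_contra h
    push Not at h
    exact hLtop (by rw [h.1, h.2]; exact Submodule.prod_top)
  refine ⟨T₀, T₁, hLK, hLQ, hne, fun ε hε hεle => ?_⟩
  -- from `X^{sat}` to `X`
  have hmono : (X.ellA : ℝ) - Module.finrank ℤ ↥(X.Ya ⊓ SL) ≤ (rkA : ℝ) - rA := by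
    have h : X.ellA - Module.finrank ℤ ↥(X.Ya ⊓ SL) ≤ rkA - rA := X.ellA_sub_le_sat SL
    have h1 : Module.finrank ℤ ↥(X.Ya ⊓ SL) ≤ X.ellA := X.finrank_inf_le_ellA SL
    have h3 : X.ellA + rA ≤ rkA + Module.finrank ℤ ↥(X.Ya ⊓ SL) := by omega
    have h4 : (X.ellA : ℝ) + rA ≤ (rkA : ℝ) + Module.finrank ℤ ↥(X.Ya ⊓ SL) := by exact_mod_cast h3
    linarith only [h4]
  refine (hclause' ε hε hεle).trans (mul_le_mul_of_nonneg_left ?_ (Nat.cast_nonneg _))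
  have := mul_le_mul_of_nonneg_left hmono (sq_nonneg ε)
  linarith only [this]

/-- **Théorème 0.2 of Roy–Waldschmidt from Théorèmes 2.1, 3.1 and 4.1.** The tree proves
Théorème 0.2 ⇐ Théorème 0.1 ⇐ Théorème 1.1 ⇐ Théorème 5.1 (§§7, 1, 6 of the paper,
`royWaldschmidt_quadratic_thm_0_2_of_thm_5_1`), the degenerate cases of Théorème 5.1
(`h51_of_generic`) and its generic case from Théorèmes 2.1, 3.1, 4.1 (`h51sub_generic_of_thms`,
`h51_of_subspaceForm`); hence the paper's Théorème 0.2 follows from: Théorème 2.1 (`h21`, the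
special case of [33, Thm. 2.1] = Waldschmidt, J. reine angew. Math. 493 (1997), stated pp. 761–762),
Théorème 3.1 (`h31`, p. 763) and Théorème 4.1 (`h41`, p. 772) for finitely generated subfields
`K ⊂ ℂ` of transcendence degree `1`.
[cite: RoyWaldschmidt1997ENS, Théorème 0.2 p. 755; §5 pp. 779–784; Théorème 2.1 pp. 761–762; Théorème 3.1 p. 763; Théorème 4.1 p. 772] -/
theorem royWaldschmidt_quadratic_thm_0_2_of_thms
    (h21 : ∀ (d₀ d₁ ℓ₀ : ℕ) (N : Type) [Fintype N] (w : Fin ℓ₀ → (Fin d₀ → ℂ) × (Fin d₁ → ℂ))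
      (η : N → (Fin d₀ → ℂ) × (Fin d₁ → ℂ))
      (Kt : IntermediateField ℚ ℂ) [FiniteDimensional ℚ Kt]
      (wt : Fin ℓ₀ → (Fin d₀ → ℂ) × (Fin d₁ → ℂ)) (ηt : N → (Fin d₀ → ℂ) × (Fin d₁ → ℂ))
      (A : Fin d₁ → ℝ) (B₁ B₂ E U V : ℝ) (S₀ T₀ T₁ : ℕ),
      (∀ j, (∀ i, (wt j).1 i ∈ Kt) ∧ ∀ i, (wt j).2 i ∈ Kt) →
      (∀ j, (∀ i, (ηt j).1 i ∈ Kt) ∧ ∀ i, cexp ((ηt j).2 i) ∈ Kt) →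
      (∃ j, LinGroup.exp (ηt j) = 1) →
      (∃ j, (η j).2 ≠ 0) →
      (∀ i, Real.exp 1 ≤ A i) → Real.exp 1 ≤ B₁ → Real.exp 1 ≤ B₂ → Real.exp 1 ≤ E → 0 < U → 0 < V →
      0 < S₀ → 0 < T₀ → 0 < T₁ → 2 * ((d₀ : ℝ) + d₁) ≤ B₁ → ((d₀ : ℝ) + d₁) ≤ B₂ →
      (∀ i : Fin d₀, weilHeight₁ Kt (fun j : N => (ηt j).1 i) ≤ Real.log B₁) →
      (∀ j, weilHeight₁ Kt (Sum.elim (wt j).1 (wt j).2 : Fin d₀ ⊕ Fin d₁ → ℂ) ≤ Real.log B₂) →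
      (∀ (i : Fin d₁) (j : N), weilHeight₁ Kt (fun _ : Unit => cexp ((ηt j).2 i)) ≤ Real.log (A i) ∧
        2 / (Module.finrank ℚ Kt : ℝ) ≤ Real.log (A i) ∧
        E / (Module.finrank ℚ Kt : ℝ) * ‖(ηt j).2 i‖ ≤ Real.log (A i)) →
      (∀ j, ‖w j - wt j‖ ≤ Real.exp (-V)) → (∀ j, ‖η j - ηt j‖ ≤ Real.exp (-V)) →
      (Module.finrank ℚ Kt : ℝ) * (T₀ * Real.log B₁) ≤ U →
      (Module.finrank ℚ Kt : ℝ) * (S₀ * Real.log B₂) ≤ U →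
      (Module.finrank ℚ Kt : ℝ) * (T₁ * ∑ i, Real.log (A i)) ≤ U →
      (12 * ((d₀ : ℝ) + d₁) + 13) * U ≤ V →
      Real.log E ≤ (Module.finrank ℚ Kt : ℝ) * Real.log B₁ →
      Real.log E ≤ (Module.finrank ℚ Kt : ℝ) * Real.log B₂ →
      ((d₀ : ℝ) + d₁) * S₀ + T₀ + d₁ * T₁ ≤ B₂ →
      ((Nat.choose (T₀ + d₀) d₀ : ℝ) * ((T₁ : ℝ) + 1) ^ d₁ ≤ 1 / 8 * Real.exp (U / (2 * Module.finrank ℚ Kt))) →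
      (4 * (V / Real.log E) ^ (Module.finrank ℂ (Submodule.span ℂ (Set.range w ∪ Set.range η))) ≤
        (Nat.choose (T₀ + d₀) d₀ : ℝ) * ((T₁ : ℝ) + 1) ^ d₁) →
      ∃ H : LinGroup.ConnAlgSubgroup d₀ d₁,
        H.tangent ≠ ⊤ ∧ LiePresentation.IsKRational Kt H.addPart ∧
        (∃ F : Set (MvPolynomial (Fin d₀ ⊕ Fin d₁) ℂ),
          (∀ P ∈ F, (∀ m, P.coeff m ∈ Kt) ∧ ∀ i : Fin d₁, P.degreeOf (Sum.inr i) ≤ T₁) ∧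
          (∀ g ∈ H.toSubgroup, ∀ P ∈ F, LinGroup.evalAt P g = 0) ∧
          ∀ H' : LinGroup.ConnAlgSubgroup d₀ d₁, H.toSubgroup ≤ H'.toSubgroup →
            (∀ g ∈ H'.toSubgroup, ∀ P ∈ F, LinGroup.evalAt P g = 0) → H'.toSubgroup = H.toSubgroup) ∧
        S₀ ^ (Module.finrank Kt ↥(Submodule.span Kt (Set.range wt)) -
            Module.finrank Kt ↥(Submodule.span Kt (Set.range wt) ⊓ (H.tangent.restrictScalars Kt))) *
          Set.ncard ((QuotientGroup.mk : LinGroup d₀ d₁ → LinGroup d₀ d₁ ⧸ H.toSubgroup) ''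
            Set.range (fun j => LinGroup.exp (ηt j))) *
          T₀ ^ H.addDim * T₁ ^ H.torusDim ≤
        (d₀ + d₁).factorial / d₀.factorial * T₀ ^ d₀ * T₁ ^ d₁)
    (h31 : ∀ (K : IntermediateField ℚ ℂ), K.FG → Algebra.trdeg ℚ K = 1 →
      ∀ (ι : Type) [Fintype ι] (a : ι → K), ∃ c : ℝ, 0 < c ∧ ∀ κ : ℝ, c ≤ κ → ∀ D₀ : ℕ, ∃ D : ℕ, D₀ ≤ D ∧
      ∃ (p : Place K) (τ : p.ring →+* ℂ) (Kt : IntermediateField ℚ ℂ), p.IsReduction τ ∧ p.deg = D ∧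
      (∀ x, τ x ∈ Kt) ∧ FiniteDimensional ℚ Kt ∧ Module.finrank ℚ Kt = D ∧
      ∃ ha : ∀ i, a i ∈ p.ring,
      weilHeight₁ Kt (fun i => τ ⟨a i, ha i⟩) ≤ κ ∧
      (∀ i, ‖(a i : ℂ) - τ ⟨a i, ha i⟩‖ ≤ Real.exp (-(κ * (D : ℝ) ^ 2 / c))) ∧
      ∀ i, IsAlgebraic ℚ (a i : ℂ) → τ ⟨a i, ha i⟩ = a i)
    (h41 : ∀ (K : IntermediateField ℚ ℂ), K.FG → Algebra.trdeg ℚ K = 1 →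
      ∀ (d₀ d₁ : ℕ) (p : Place K) (τ : p.ring →+* ℂ), p.IsReduction τ →
      ∀ (Kt : IntermediateField ℚ ℂ) [FiniteDimensional ℚ Kt], (∀ x, τ x ∈ Kt) → Module.finrank ℚ Kt = p.deg →
      ∀ (ℓ₀ : ℕ) (N : Type) [Fintype N] (T₁ : ℕ) (w : Fin ℓ₀ → (Fin d₀ → ℂ) × (Fin d₁ → ℂ))
      (hw : ∀ j, (∀ i, (w j).1 i ∈ K) ∧ ∀ i, (w j).2 i ∈ K), LinearIndependent K w →
      ∀ (γ : N → LinGroup d₀ d₁)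
      (hγ : ∀ j, (∀ i, Multiplicative.toAdd (γ j).1 i ∈ K) ∧ ∀ i, ((γ j).2 i : ℂ) ∈ K)
      (H : LinGroup.ConnAlgSubgroup d₀ d₁), LiePresentation.IsKRational Kt H.addPart →
      (∃ F : Set (MvPolynomial (Fin d₀ ⊕ Fin d₁) ℂ),
      (∀ P ∈ F, (∀ m, P.coeff m ∈ Kt) ∧ ∀ i : Fin d₁, P.degreeOf (Sum.inr i) ≤ T₁) ∧
      (∀ g ∈ H.toSubgroup, ∀ P ∈ F, LinGroup.evalAt P g = 0) ∧
      ∀ H' : LinGroup.ConnAlgSubgroup d₀ d₁, H.toSubgroup ≤ H'.toSubgroup →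
      (∀ g ∈ H'.toSubgroup, ∀ P ∈ F, LinGroup.evalAt P g = 0) → H'.toSubgroup = H.toSubgroup) →
      (∀ j, (∀ i, (⟨(w j).1 i, (hw j).1 i⟩ : K) ∈ p.ring) ∧ ∀ i, (⟨(w j).2 i, (hw j).2 i⟩ : K) ∈ p.ring) →
      (∀ j, (∀ i, (⟨Multiplicative.toAdd (γ j).1 i, (hγ j).1 i⟩ : K) ∈ p.ring) ∧
      ∀ i, (⟨((γ j).2 i : ℂ), (hγ j).2 i⟩ : K) ∈ p.ring ∧ (⟨((γ j).2 i : ℂ)⁻¹, inv_mem ((hγ j).2 i)⟩ : K) ∈ p.ring) →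
      ∀ (wt : Fin ℓ₀ → (Fin d₀ → ℂ) × (Fin d₁ → ℂ)) (γt : N → LinGroup d₀ d₁),
      (∀ j, (∀ i (h : (⟨(w j).1 i, (hw j).1 i⟩ : K) ∈ p.ring), (wt j).1 i = τ ⟨_, h⟩) ∧
      ∀ i (h : (⟨(w j).2 i, (hw j).2 i⟩ : K) ∈ p.ring), (wt j).2 i = τ ⟨_, h⟩) →
      (∀ j, (∀ i (h : (⟨Multiplicative.toAdd (γ j).1 i, (hγ j).1 i⟩ : K) ∈ p.ring),
      Multiplicative.toAdd (γt j).1 i = τ ⟨_, h⟩) ∧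
      ∀ i (h : (⟨((γ j).2 i : ℂ), (hγ j).2 i⟩ : K) ∈ p.ring), ((γt j).2 i : ℂ) = τ ⟨_, h⟩) →
      ∀ (A' : Fin d₁ → ℝ) (B₁ B₂ : ℝ), (∀ i, Real.exp 1 ≤ A' i) → Real.exp 1 ≤ B₁ → Real.exp 1 ≤ B₂ →
      (∀ i : Fin d₀, (ffHeight₁ (fun j : N => (⟨Multiplicative.toAdd (γ j).1 i, (hγ j).1 i⟩ : K)) : ℝ) ≤ Real.log B₁) →
      (∀ j, (ffHeight₁ (Sum.elim (fun i => (⟨(w j).1 i, (hw j).1 i⟩ : K)) (fun i => (⟨(w j).2 i, (hw j).2 i⟩ : K))) : ℝ)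
      ≤ Real.log B₂) →
      (∀ (i : Fin d₁) (j : N), (ffHeight₁ (fun _ : Unit => (⟨((γ j).2 i : ℂ), (hγ j).2 i⟩ : K)) : ℝ) ≤ Real.log (A' i)) →
      max (2 * (d₁ : ℝ) * ((T₁ : ℝ) * ∑ i, Real.log (A' i))) (2 * (d₀ : ℝ) * Real.log B₁ + ℓ₀ * Real.log B₂) < p.deg →
      ∃ L : LinGroup.ConnAlgSubgroup d₀ d₁,
      LiePresentation.IsKRational K L.addPart ∧ L.addDim = H.addDim ∧ L.torusDim = H.torusDim ∧
      Set.ncard ((QuotientGroup.mk : LinGroup d₀ d₁ → LinGroup d₀ d₁ ⧸ L.toSubgroup) '' Set.range γ) ≤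
      Set.ncard ((QuotientGroup.mk : LinGroup d₀ d₁ → LinGroup d₀ d₁ ⧸ H.toSubgroup) '' Set.range γt) ∧
      Module.finrank K ↥(Submodule.span K (Set.range w)) -
      Module.finrank K ↥(Submodule.span K (Set.range w) ⊓ (L.tangent.restrictScalars K)) ≤
      Module.finrank Kt ↥(Submodule.span Kt (Set.range wt)) -
      Module.finrank Kt ↥(Submodule.span Kt (Set.range wt) ⊓ (H.tangent.restrictScalars Kt))) :
    royWaldschmidt_quadratic_thm_0_2 :=
  royWaldschmidt_quadratic_thm_0_2_of_thm_5_1 fun K hfg htr X hd =>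
    h51_of_generic X hd fun hgen hn hd₀n hd₁ hY =>
      h51_of_subspaceForm X (h51sub_generic_of_thms h21 (h31 K hfg htr) (h41 K hfg htr) hfg htr X hgen hn hd₀n hd₁ hY)

end RoyWaldschmidt1997

end Literature.NumberTheory.Transcendental
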